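import Summits.BirchSwinnertonDyer.Rank1Residual.Additive.BudgetFromRationalClasses
import HarnessLib

/-!
# The Route-G budget from classes of `Sel_{p^∞}(E/ℚ_∞)[p]` (the `…_of_selmerInftyClasses` socket)

Cell `b2b-bsdres`, team n1011, seat p10 GEN 4, row **T-E3g-BUDn** (the budget door at level `n`,
ROUTE-2 II.17; sequel of T-E3g-BUD0).  FILE N1: the SOCKET the level-`n` programme plugs into.

`BudgetLeLambdaAt p W b` asks `b ≤ λ(X(E/ℚ_∞))` for every cyclotomic `κ` and every torsion
Selmer-dual datum with `μ = 0`.  By p12's `pow_lambdaInvariant_eq_natCard_selmer_torsion`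
(`#Sel_{p^∞}(E/ℚ_∞)[p] = p^λ` when `X` has no nonzero finite `Λ`-submodule, Greenberg Prop. 4.14) it
suffices to exhibit, for every cyclotomic `κ`, `p^b` classes of `Sel_{p^∞}(E/ℚ_∞)[p]`
(`budgetLeLambdaAt_of_noFiniteSubmodule_of_selmerInftyClasses`,
`budgetLeLambdaAt_of_prop414_of_selmerInftyClasses`).  FILE 1 (`…_of_layerClasses`) is the special
case where the classes come from `A_n[p]` by the injective `h_n`.

Option B of II.17.7 ("restrict the tower") produces such classes from a number field `K'` (a layer
`ℚ_n`), a `ℤ_p`-extension `κ'` of `K'` and an injective additive transport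
`Sel_{p^∞}(E/K'_{∞}) ↪ Sel_{p^∞}(E/ℚ_∞)` (row T-E3g-BUDn-K, p01): §2 records the bookkeeping
`exists_finset_selmerInfty_torsion_of_injective` (classes of `A'_0[p]` over `K'` with `E(K')[p] = 0`
give as many classes of `Sel_{p^∞}(E/ℚ_∞)[p]`), so that the K-general level-`0` socket
`exists_finset_layerZero_of_tamagawaWitnesses` (FILE 4b) at `K' = ℚ_n` feeds this file.

References: Greenberg, LNM 1716 (1999), §3 pp. 85–86, Prop. 4.14 p. 114, §5 pp. 114–118 (proof of
Cor. 5.6; the example 406D1, p. 184 of the Park City notes); K. Matsuno, *Construction of elliptic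
curves with large Iwasawa λ-invariants and large Tate–Shafarevich groups*, Manuscripta Math. 122
(2007), Lemma 3.5, Remark, §4.  What is new here relative to these: additive reduction at `p` is
allowed (the budget is image-free and reduction-free at `p`), one inequality per layer, kernel form.
-/

set_option autoImplicit false

noncomputable section

open scoped Classical

open WeierstrassCurve Literature.NumberTheory.EllipticCurves
  Literature.NumberTheory.EllipticCurves.Rank1Residual

universe u

namespace Summit.BirchSwinnertonDyer.Rank1Residual.Additive

/-! ### §1 The socket: classes of `Sel_{p^∞}(E/ℚ_∞)[p]` bound `λ` below -/

section Socket

variable {W : WeierstrassCurve ℚ} [W.IsElliptic] [W.IsGloballyMinimal] {p : ℕ} [hp : Fact p.Prime]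

/-- **The Route-G budget from classes of `Sel_{p^∞}(E/ℚ_∞)[p]` (no-finite-submodule form).** If
`X(E/ℚ_∞)` has no nonzero finite `Λ`-submodule for every cyclotomic datum (`NoFiniteSubmoduleAt p W`)
and for every cyclotomic `κ` the group `Sel_{p^∞}(E/ℚ_∞)[p]` contains a finite set of at least `p^b`
classes, then `BudgetLeLambdaAt p W b` (`p^b ≤ #Sel_∞[p] = p^λ`, p12's
`pow_lambdaInvariant_eq_natCard_selmer_torsion`). [cite: GreenbergLNM1716, Prop. 4.14 (p. 114)] -/
theorem budgetLeLambdaAt_of_noFiniteSubmodule_of_selmerInftyClasses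
    (hnf : NoFiniteSubmoduleAt p W) {b : ℕ}
    (hA : ∀ (κ : ZpExtension ℚ p), κ.IsCyclotomic →
      ∃ s : Finset {y : W.selmerInfty κ // p • y = 0}, p ^ b ≤ s.card) :
    BudgetLeLambdaAt p W b := by
  intro κ γ hκ hγ hT D _ hXt hμ
  have hnf' : ∀ N : Submodule (IwasawaAlgebra p) D.X, Finite N → N = ⊥ := hnf hκ hγ hT D hXt
  have hfin := finite_selmer_torsion_of_mu_zero_of_forall_finite_eq_bot p D hXt hμ hnf'
  have hcard := pow_lambdaInvariant_eq_natCard_selmer_torsion p D hXt hμ hnf'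
  obtain ⟨s, hs⟩ := hA κ hκ
  haveI : Fintype {y : W.selmerInfty κ // p • y = 0} := Fintype.ofFinite _
  have h := hs.trans (Finset.card_le_univ s)
  rw [← Nat.card_eq_fintype_card, ← hcard] at h
  exact (Nat.pow_le_pow_iff_right hp.out.one_lt).mp h

/-- **The Route-G budget from classes of `Sel_{p^∞}(E/ℚ_∞)[p]`, on rows with `p ∤ #E(ℚ)_tors`**
(Greenberg's Prop. 4.14 record `prop414_noFiniteSubmodule_of_not_dvd_torsionOrder` BY NAME):
`(∀ κ cyclotomic, p^b` classes in `Sel_{p^∞}(E/ℚ_∞)[p]) ⟹ BudgetLeLambdaAt p W b`.  This is the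
socket of the level-`n` programme (ROUTE-2 II.17, Option B). [cite: GreenbergLNM1716, Prop. 4.14 (p. 114)] -/
theorem budgetLeLambdaAt_of_prop414_of_selmerInftyClasses
    (h414 : Greenberg1999.prop414_noFiniteSubmodule_of_not_dvd_torsionOrder)
    (htors : ¬ p ∣ W.torsionOrder) {b : ℕ}
    (hA : ∀ (κ : ZpExtension ℚ p), κ.IsCyclotomic →
      ∃ s : Finset {y : W.selmerInfty κ // p • y = 0}, p ^ b ≤ s.card) :
    BudgetLeLambdaAt p W b :=
  budgetLeLambdaAt_of_noFiniteSubmodule_of_selmerInftyClasses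
    (noFiniteSubmoduleAt_of_prop414 h414 htors) hA

/-- **The residual count from classes of `Sel_{p^∞}(E/ℚ_∞)[p]`**: with `Sel_{p^∞}(E/ℚ_∞)[p]` finite
for every cyclotomic `κ`, `p^b` such classes give `ResidualSelmerRankGeAt p W b`. [folklore] -/
theorem residualSelmerRankGeAt_of_selmerInftyClasses {b : ℕ}
    (hfin : ∀ (κ : ZpExtension ℚ p), κ.IsCyclotomic → Finite {s : W.selmerInfty κ // p • s = 0})
    (hA : ∀ (κ : ZpExtension ℚ p), κ.IsCyclotomic →
      ∃ s : Finset {y : W.selmerInfty κ // p • y = 0}, p ^ b ≤ s.card) :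
    ResidualSelmerRankGeAt p W b := by
  intro κ hκ
  obtain ⟨s, hs⟩ := hA κ hκ
  haveI : Fintype {y : W.selmerInfty κ // p • y = 0} := @Fintype.ofFinite _ (hfin κ hκ)
  rw [Nat.card_eq_fintype_card]
  exact hs.trans (Finset.card_le_univ s)

end Socket

/-! ### §2 Bookkeeping for Option B: classes over a restricted tower transport to `Sel_{p^∞}(E/ℚ_∞)[p]` -/

section Transport

variable {K : Type u} [Field K] [NumberField K] (W : WeierstrassCurve K) (p : ℕ)
  [hp : Fact p.Prime] (κ : ZpExtension K p)

/-- **Transport of `p`-torsion classes along an injective additive map of Selmer groups.** If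
`f : Sel' ↪ Sel_{p^∞}(E/K_∞)` is an injective additive map from some group `Sel'` (e.g. the Selmer
group of the tower restricted to a layer, row T-E3g-BUDn-K's `T-res`), a finite set of `p`-torsion
classes of `Sel'` gives a finite set of `p`-torsion classes of `Sel_{p^∞}(E/K_∞)` of the same size.
[folklore] -/
theorem exists_finset_selmerInfty_torsion_of_injective {A : Type*} [AddCommGroup A]
    (f : A →+ W.selmerInfty κ) (hf : Function.Injective f) (s : Finset {a : A // p • a = 0}) :
    ∃ t : Finset {y : W.selmerInfty κ // p • y = 0}, t.card = s.card := by
  let g : {a : A // p • a = 0} → {y : W.selmerInfty κ // p • y = 0} :=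
    fun a ↦ ⟨f a.1, by rw [← map_nsmul, a.2, map_zero]⟩
  have hg : Function.Injective g := fun a b h ↦ Subtype.ext (hf (congrArg Subtype.val h))
  exact ⟨s.map ⟨g, hg⟩, Finset.card_map _⟩

/-- **From `A'_0[p]` over a number field `K'` to `Sel_{p^∞}(E/K_∞)[p]`.** Let `K'` be a number
field with `E(K')[p] = 0`, `κ'` a `ℤ_p`-extension of `K'` and
`f : Sel_{p^∞}(E_{K'}/K'_∞) ↪ Sel_{p^∞}(E/K_∞)` injective additive (the restricted-tower transport).
Then a finite set of classes of `A'_0[p] = {z ∈ H¹(K', E[p^∞]) : h_0 z ∈ Sel_{p^∞}(E_{K'}/K'_∞)}[p]`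
gives as many classes of `Sel_{p^∞}(E/K_∞)[p]` (`h_0` is injective: FILE 1's
`exists_injective_torsion_selmerInftyPreimage_to_selmerInfty`). [cite: GreenbergLNM1716, §3 pp. 85–86] -/
theorem exists_finset_selmerInfty_torsion_of_layerZero {K' : Type u} [Field K'] [NumberField K']
    (W' : WeierstrassCurve K') [W'.IsElliptic] (κ' : ZpExtension K' p)
    (hK' : ∀ P : W'.toAffine.Point, p • P = 0 → P = 0)
    (f : W'.selmerInfty κ' →+ W.selmerInfty κ) (hf : Function.Injective f)
    (s : Finset {z : W'.selmerInftyPreimage κ' 0 // p • z = 0}) :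
    ∃ t : Finset {y : W.selmerInfty κ // p • y = 0}, t.card = s.card := by
  obtain ⟨g, hg⟩ := exists_injective_torsion_selmerInftyPreimage_to_selmerInfty W' κ' hK' 0
  obtain ⟨t, ht⟩ := exists_finset_selmerInfty_torsion_of_injective W p κ f hf (s.map ⟨g, hg⟩)
  exact ⟨t, ht.trans (Finset.card_map _)⟩

end Transport

end Summit.BirchSwinnertonDyer.Rank1Residual.Additive
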